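import Summits.HubbardSuperconductivity.HubbardSuperconductivity.Theorems.AnisotropyChordTransferFibre3RowDLoopBdry
import Summits.HubbardSuperconductivity.HubbardSuperconductivity.Theorems.AnisotropyChordTransferFibre3RowDBTerm
import Summits.HubbardSuperconductivity.HubbardSuperconductivity.Theorems.AnisotropyChordTransferFibre3N1RowNamed

/-!
# Route `AnisotropyChord` / H0 rotor rung, row D (KT-2a) Stage-1b: the loop-majorant TABLES as `RExpr` in the row-D box (hat units)

Stage-1b of the row-D program (p1 g30).  The natural-unit tables of `…RowDLoopTables` / `…RowDLoopBdry` (`bnd3`, `bndM`, `bpg`, `bsp`, in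
`a, c_s, S₁, S₂, V, c_Z, g_max`) divided by the row-D normalisation `V³t` (N-type, boundary) resp. `V³` (M-type, `Π̂`) are `t`-regular
expressions in the box atoms `t, π², ν, a` (coords 0–3), `Ŝ₂ = θ⁴S₂` (coord 4), `ê₁` (coord 16) and p2's `cs, uu, S1h = Ŝ₁ = 4π²u/c_s`:
`S₁ = Ŝ₁/t`, `S₂ = Ŝ₂/t²`, `V = 4π²/t`, `g_max = ĝ_max/t` with `ĝ_max = 1/(2ê₁ − ν)`, `c_Z = π²/(4 − π²ν)`.
* atoms: ★ `xTrueD_four`, `xTrueD_e1`, ★ `eval_S1h_D` (`Ŝ₁ = tS₁` via the gap equation `c_sS₁ = V − a(V−1)`), `eval_cZE`, `eval_gmaxE`;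
* tables ★ `bnd3E`, `bndME`, `bpgE`, `bspE` and ★ `eval_bnd3E : eval = bnd3At/(V³t)`, ★ `eval_bndME : eval = bndMAt/V³`,
  ★ `eval_bpgE : eval = bpgAt/(V³t)`, ★ `eval_bspE : eval = bspAt/(V³t)` (ground profile located in a row-D cell, `L ≥ 128`).
Prover seat `hubbard-h0-rotor-p1` g30 (route lead); helper for piece A = stmt-HubbardSuperconductivity-23918 of rung 19089
(`--supports`, helper class).  Nothing here proves superconductivity in the Hubbard model; lemmas for ONE row of ONE conditional reduction;
the rotor TARGET as originally worded stays FALSE (g15 verdict).  Tree imports only; no sorry.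
-/

set_option linter.dupNamespace false
set_option autoImplicit false

open Literature.Analysis.ValidatedNumerics

namespace Summit.HubbardSuperconductivity.HubbardSuperconductivity.Theorems.AnisotropyChord.Transfer.Fibre3

namespace RowD

open RowC L2.N1

variable (L : ℕ) [NeZero L]

/-! ## Atoms -/

/-- `1/(4π²)³`. -/
def K3E : RExpr := .inv (.mul (.mul (.mul (cst 4) vPi2) (.mul (cst 4) vPi2)) (.mul (cst 4) vPi2))
/-- the zone constant `c_Z = π²/(4 − π²ν)`. -/
def cZE : RExpr := .mul vPi2 (.inv (.sub (cst 4) eta))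
/-- `ĝ_max = 1/(2ê₁ − ν)`. -/
def gmaxE : RExpr := .inv (.sub (.mul (cst 2) vE1) vNu)

section atoms
variable (Δ lam2 : ℝ) (f : Tor L → ℝ)

/-- coordinate `4` is `Ŝ₂ = θ⁴S₂`. -/
theorem xTrueD_four : xTrueD L Δ lam2 f 4 = ((2 * Real.pi / L) ^ 2) ^ 2 * S2n L lam2 := by
  rw [xTrueD_lt L Δ lam2 f (by norm_num), (xTrue_145 L Δ lam2 f _).2.1]; ring

/-- coordinate `16` is `ê₁ = ε₁/θ²`. -/
theorem xTrueD_e1 : xTrueD L Δ lam2 f 16 = eps1 L / (2 * Real.pi / L) ^ 2 := by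
  rw [xTrueD_lt L Δ lam2 f (by norm_num), xTrue_16]; rfl

/-- `K3E ↦ 1/(4π²)³`. -/
theorem eval_K3E : K3E.eval (xTrueD L Δ lam2 f) = 1 / (4 * Real.pi ^ 2) ^ 3 := by
  simp only [K3E, RExpr.eval, cst, vPi2, xTrueD_one]; push_cast; ring

/-- `cZE ↦ c_Z(ν)`. -/
theorem eval_cZE : cZE.eval (xTrueD L Δ lam2 f) = cZ (lam2 / (2 * Real.pi / L) ^ 2) := by
  simp only [cZE, cZ, RExpr.eval, cst, vPi2, eta, vNu, xTrueD_one, xTrueD_two]; push_cast; ring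

/-- `gmaxE ↦ θ²·g_max = θ²/(2ε₁ − λ₂)`. -/
theorem eval_gmaxE : gmaxE.eval (xTrueD L Δ lam2 f) = (2 * Real.pi / L) ^ 2 * (1 / (2 * eps1 L - lam2)) := by
  have hLpos : (0 : ℝ) < L := by exact_mod_cast Nat.pos_of_ne_zero (NeZero.ne L)
  have ht : (2 * Real.pi / L : ℝ) ^ 2 ≠ 0 := by positivity
  simp only [gmaxE, RExpr.eval, cst, vE1, vNu, xTrueD_e1, xTrueD_two]
  push_cast
  rw [show (2 : ℝ) * (eps1 L / (2 * Real.pi / L) ^ 2) - lam2 / (2 * Real.pi / L) ^ 2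
      = (2 * eps1 L - lam2) / (2 * Real.pi / L) ^ 2 by field_simp]
  rw [inv_div]; field_simp

/-- ★ `S1h ↦ Ŝ₁ = θ²S₁` at the row-D vector (ground profile, `L ≥ 128`; gap equation `c_sS₁ = V − a(V−1) = V·u`). [folklore] -/
theorem eval_S1h_D (hL : 128 ≤ L) (hΔ0 : 0 ≤ Δ) (hΔ1 : Δ < 1) (hf : IsGroundTwoMagnon L Δ lam2 f) :
    S1h.eval (xTrueD L Δ lam2 f) = (2 * Real.pi / L) ^ 2 * S1n L lam2 := by
  have hlam : 0 < lam2 := lam2_pos L (by omega) hΔ1 hf.1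
  obtain ⟨_, dcs, duu⟩ := dictD L Δ lam2 f (by omega) hΔ0 hΔ1 hf hlam
  have hgap := gapEquationS1_holds L (by omega) hΔ0 hΔ1 lam2 f hf hlam
  unfold aPar at hgap
  obtain ⟨ha0, haV, -, -⟩ := ManifoldA.manifold_band L hL hΔ0 hΔ1 hf
  have hLpos : (0 : ℝ) < L := by exact_mod_cast (show 0 < L by omega)
  have hV : (0 : ℝ) < (L : ℝ) ^ 2 := by positivity
  have hu : 0 < 1 - Δ * f (K1 L) + Δ * f (K1 L) / (L : ℝ) ^ 2 := by
    have : Δ * f (K1 L) * (1 - 1 / (L : ℝ) ^ 2) = Δ * f (K1 L) - Δ * f (K1 L) / (L : ℝ) ^ 2 := by ring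
    linarith
  have hcs : cS L Δ lam2 f ≠ 0 := by
    intro h0
    rw [h0, zero_mul] at hgap
    have : (L : ℝ) ^ 2 - Δ * f (K1 L) * ((L : ℝ) ^ 2 - 1) = (L : ℝ) ^ 2 * (1 - Δ * f (K1 L) + Δ * f (K1 L) / (L : ℝ) ^ 2) := by
      field_simp; ring
    rw [this] at hgap
    have := mul_pos hV hu
    linarith
  simp only [S1h, RExpr.eval, cst, vPi2, xTrueD_one, dcs, duu]
  push_cast
  have hS : S1n L lam2 = ((L : ℝ) ^ 2 - Δ * f (K1 L) * ((L : ℝ) ^ 2 - 1)) / cS L Δ lam2 f := by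
    rw [eq_div_iff hcs, mul_comm]; exact hgap
  rw [hS]
  field_simp
  ring

end atoms

/-! ## The tables in hat units -/

/-- N-type table `/(V³t)`. -/
def bnd3E (ku kw kw' : Bool) : RExpr :=
  match ku, kw, kw' with
  | true, true, true => .mul (.mul (.mul (.mul (.mul cs cs) cs) cZE) vS2) K3E
  | true, true, false => .mul (.mul (.mul (.mul cs cs) (.mul (cst 2) vA)) (.sqrt (.mul (.mul (.mul cZE vS2) S1h) vT))) K3E
  | true, false, true => .mul (.mul (.mul (.mul cs cs) (.mul (cst 2) vA)) (.sqrt (.mul (.mul (.mul cZE vS2) S1h) vT))) K3E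
  | true, false, false => .mul (.mul (.mul (.mul cs (.sq (.mul (cst 2) vA))) S1h) vT) K3E
  | false, true, true => .mul (.mul (.mul (.mul (.mul vA (.mul cs cs)) cZE) S1h) vT) K3E
  | false, true, false => .mul (.mul (.mul (.mul (.mul vA cs) (.mul (cst 2) vA)) (.sqrt (.mul (.mul cZE S1h) (.mul (cst 4) vPi2)))) vT) K3E
  | false, false, true => .mul (.mul (.mul (.mul (.mul vA cs) (.mul (cst 2) vA)) (.sqrt (.mul (.mul cZE S1h) (.mul (cst 4) vPi2)))) vT) K3E
  | false, false, false => .mul (.mul (.mul (.mul vA (.sq (.mul (cst 2) vA))) (.mul (cst 4) vPi2)) vT) K3E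

/-- plain table `/V³`. -/
def bndME (k3 k1 k2 : Bool) : RExpr :=
  match k3, k1, k2 with
  | true, true, true => .mul (.mul (.mul (.mul (.mul cs cs) cs) gmaxE) vS2) K3E
  | true, true, false => .mul (.mul (.mul (.mul vA (.mul cs cs)) vS2) vT) K3E
  | true, false, true => .mul (.mul (.mul (.mul vA (.mul cs cs)) vS2) vT) K3E
  | false, true, true => .mul (.mul (.mul (.mul vA (.mul cs cs)) vS2) vT) K3E
  | true, false, false => .mul (.mul (.mul (.mul (.sq vA) cs) S1h) (.sq vT)) K3E
  | false, true, false => .mul (.mul (.mul (.mul (.sq vA) cs) S1h) (.sq vT)) K3E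
  | false, false, true => .mul (.mul (.mul (.mul (.sq vA) cs) S1h) (.sq vT)) K3E
  | false, false, false => .mul (.mul (.mul (.mul (.sq vA) vA) (.mul (cst 4) vPi2)) (.sq vT)) K3E

/-- plain × gradient pair table `/(V³t)`. -/
def bpgE (k k' : Bool) : RExpr :=
  match k, k' with
  | true, true => .mul (.mul (.mul cs cs) (.sqrt (.mul (.mul (.mul cZE vS2) S1h) vT))) K3E
  | true, false => .mul (.mul (.mul (.mul cs (.mul (cst 2) vA)) S1h) vT) K3E
  | false, true => .mul (.mul (.mul (.mul vA cs) (.sqrt (.mul (.mul cZE S1h) (.mul (cst 4) vPi2)))) vT) K3E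
  | false, false => .mul (.mul (.mul (.mul vA (.mul (cst 2) vA)) (.mul (cst 4) vPi2)) vT) K3E

/-- shift × plain pair table `/(V³t)`. -/
def bspE (k k' : Bool) : RExpr :=
  match k, k' with
  | true, true => .mul (.mul (.mul cs cs) vS2) K3E
  | true, false => .mul (.mul (.mul (.mul cs vA) S1h) vT) K3E
  | false, true => .mul (.mul (.mul (.mul vA cs) S1h) vT) K3E
  | false, false => .mul (.mul (.mul (.mul vA vA) (.mul (cst 4) vPi2)) vT) K3E

section evals
variable (Δ lam2 : ℝ) (f : Tor L → ℝ)

/-- the common atom facts, with `V = L²` eliminated: `L² = 4π²/t`. [folklore] -/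
theorem atom_facts (hL : 128 ≤ L) (hΔ0 : 0 ≤ Δ) (hΔ1 : Δ < 1) (hf : IsGroundTwoMagnon L Δ lam2 f) :
    (xTrueD L Δ lam2 f 0 = (2 * Real.pi / L) ^ 2) ∧ (xTrueD L Δ lam2 f 1 = Real.pi ^ 2) ∧
    (xTrueD L Δ lam2 f 3 = Δ * f (K1 L)) ∧ (xTrueD L Δ lam2 f 4 = ((2 * Real.pi / L) ^ 2) ^ 2 * S2n L lam2) ∧
    cs.eval (xTrueD L Δ lam2 f) = cS L Δ lam2 f ∧ S1h.eval (xTrueD L Δ lam2 f) = (2 * Real.pi / L) ^ 2 * S1n L lam2 ∧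
    cZE.eval (xTrueD L Δ lam2 f) = cZ (lam2 / (2 * Real.pi / L) ^ 2) ∧
    gmaxE.eval (xTrueD L Δ lam2 f) = (2 * Real.pi / L) ^ 2 * (1 / (2 * eps1 L - lam2)) ∧
    K3E.eval (xTrueD L Δ lam2 f) = 1 / (4 * Real.pi ^ 2) ^ 3 ∧ ((L : ℝ) ^ 2 = 4 * Real.pi ^ 2 / (2 * Real.pi / L) ^ 2) := by
  have hlam : 0 < lam2 := lam2_pos L (by omega) hΔ1 hf.1
  obtain ⟨_, dcs, _⟩ := dictD L Δ lam2 f (by omega) hΔ0 hΔ1 hf hlam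
  have hLpos : (0 : ℝ) < L := by exact_mod_cast (show 0 < L by omega)
  refine ⟨xTrueD_zero L Δ lam2 f, xTrueD_one L Δ lam2 f, xTrueD_three L Δ lam2 f, xTrueD_four L Δ lam2 f, dcs,
    eval_S1h_D L Δ lam2 f hL hΔ0 hΔ1 hf, eval_cZE L Δ lam2 f, eval_gmaxE L Δ lam2 f, eval_K3E L Δ lam2 f, ?_⟩
  field_simp
  ring

/-- `√(cz·(t²S₂)·(tS₁)·t) = t²·√(cz·S₂·S₁)`. [folklore] -/
theorem sqrt_hat1 {t cz S1 S2 : ℝ} :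
    Real.sqrt (cz * (t ^ 2 * S2) * (t * S1) * t) = t ^ 2 * Real.sqrt (cz * S2 * S1) := by
  rw [show cz * (t ^ 2 * S2) * (t * S1) * t = (t ^ 2) ^ 2 * (cz * S2 * S1) by ring,
    Real.sqrt_mul (by positivity), Real.sqrt_sq (by positivity)]

/-- `√(cz·(tS₁)·P) = t·√(cz·S₁·(P/t))` (`t > 0`). [folklore] -/
theorem sqrt_hat2 {t cz S1 P : ℝ} (ht : 0 < t) :
    Real.sqrt (cz * (t * S1) * P) = t * Real.sqrt (cz * S1 * (P / t)) := by
  rw [show cz * (t * S1) * P = t ^ 2 * (cz * S1 * (P / t)) by field_simp,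
    Real.sqrt_mul (by positivity), Real.sqrt_sq ht.le]

/-- ★ `bnd3E ↦ bnd3At/(V³t)`. [folklore] -/
theorem eval_bnd3E (hL : 128 ≤ L) (hΔ0 : 0 ≤ Δ) (hΔ1 : Δ < 1) (hf : IsGroundTwoMagnon L Δ lam2 f) (ku kw kw' : Bool) :
    (bnd3E ku kw kw').eval (xTrueD L Δ lam2 f) = bnd3At L Δ lam2 f ku kw kw' / (((L : ℝ) ^ 2) ^ 3 * (2 * Real.pi / L) ^ 2) := by
  obtain ⟨h0, h1, h3, h4, hcs, hS1, hcz, -, hK3, hV⟩ := atom_facts L Δ lam2 f hL hΔ0 hΔ1 hf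
  have hLpos : (0 : ℝ) < L := by exact_mod_cast (show 0 < L by omega)
  have ht : 0 < (2 * Real.pi / L : ℝ) ^ 2 := by positivity
  have hπ : Real.pi ≠ 0 := Real.pi_ne_zero
  unfold bnd3At bnd3
  rw [hV]
  cases ku <;> cases kw <;> cases kw' <;>
    simp only [bnd3E, RExpr.eval, cst, vA, vS2, vT, vPi2, h0, h1, h3, h4, hcs, hS1, hcz, hK3]
  · push_cast
    generalize cZ (lam2 / (2 * Real.pi / L) ^ 2) = cz
    field_simp
  · push_cast
    rw [sqrt_hat2 ht]
    generalize cZ (lam2 / (2 * Real.pi / L) ^ 2) = cz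
    generalize Real.sqrt (cz * S1n L lam2 * (4 * Real.pi ^ 2 / (2 * Real.pi / ↑L) ^ 2)) = sq
    field_simp
  · push_cast
    rw [sqrt_hat2 ht]
    generalize cZ (lam2 / (2 * Real.pi / L) ^ 2) = cz
    generalize Real.sqrt (cz * S1n L lam2 * (4 * Real.pi ^ 2 / (2 * Real.pi / ↑L) ^ 2)) = sq
    field_simp
  · generalize cZ (lam2 / (2 * Real.pi / L) ^ 2) = cz
    field_simp
  · push_cast
    generalize cZ (lam2 / (2 * Real.pi / L) ^ 2) = cz
    field_simp
  · push_cast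
    rw [sqrt_hat1]
    generalize cZ (lam2 / (2 * Real.pi / L) ^ 2) = cz
    generalize Real.sqrt (cz * S2n L lam2 * S1n L lam2) = sq
    field_simp
  · push_cast
    rw [sqrt_hat1]
    generalize cZ (lam2 / (2 * Real.pi / L) ^ 2) = cz
    generalize Real.sqrt (cz * S2n L lam2 * S1n L lam2) = sq
    field_simp
  · generalize cZ (lam2 / (2 * Real.pi / L) ^ 2) = cz
    field_simp

/-- ★ `bndME ↦ bndMAt/V³`. [folklore] -/
theorem eval_bndME (hL : 128 ≤ L) (hΔ0 : 0 ≤ Δ) (hΔ1 : Δ < 1) (hf : IsGroundTwoMagnon L Δ lam2 f) (k3 k1 k2 : Bool) :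
    (bndME k3 k1 k2).eval (xTrueD L Δ lam2 f) = bndMAt L Δ lam2 f k3 k1 k2 / ((L : ℝ) ^ 2) ^ 3 := by
  obtain ⟨h0, h1, h3, h4, hcs, hS1, -, hgm, hK3, hV⟩ := atom_facts L Δ lam2 f hL hΔ0 hΔ1 hf
  have hLpos : (0 : ℝ) < L := by exact_mod_cast (show 0 < L by omega)
  have ht : 0 < (2 * Real.pi / L : ℝ) ^ 2 := by positivity
  have hπ : Real.pi ≠ 0 := Real.pi_ne_zero
  have hε : 2 * eps1 L - lam2 ≠ 0 := by
    have := lam2_lt_two_eps1 L (by omega) hΔ0 hf; linarith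
  unfold bndMAt bndM
  rw [hV]
  cases k3 <;> cases k1 <;> cases k2 <;>
    simp only [bndME, RExpr.eval, cst, vA, vS2, vT, vPi2, h0, h1, h3, h4, hcs, hS1, hgm, hK3]
  · push_cast
    field_simp
  · field_simp
  · field_simp
  · field_simp
  · field_simp
  · field_simp
  · field_simp
  · field_simp

/-- ★ `bpgE ↦ bpgAt/(V³t)`. [folklore] -/
theorem eval_bpgE (hL : 128 ≤ L) (hΔ0 : 0 ≤ Δ) (hΔ1 : Δ < 1) (hf : IsGroundTwoMagnon L Δ lam2 f) (k k' : Bool) :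
    (bpgE k k').eval (xTrueD L Δ lam2 f) = bpgAt L Δ lam2 f k k' / (((L : ℝ) ^ 2) ^ 3 * (2 * Real.pi / L) ^ 2) := by
  obtain ⟨h0, h1, h3, h4, hcs, hS1, hcz, -, hK3, hV⟩ := atom_facts L Δ lam2 f hL hΔ0 hΔ1 hf
  have hLpos : (0 : ℝ) < L := by exact_mod_cast (show 0 < L by omega)
  have ht : 0 < (2 * Real.pi / L : ℝ) ^ 2 := by positivity
  have hπ : Real.pi ≠ 0 := Real.pi_ne_zero
  unfold bpgAt bpg
  rw [hV]
  cases k <;> cases k' <;>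
    simp only [bpgE, RExpr.eval, cst, vA, vS2, vT, vPi2, h0, h1, h3, h4, hcs, hS1, hcz, hK3]
  · push_cast
    generalize cZ (lam2 / (2 * Real.pi / L) ^ 2) = cz
    field_simp
  · push_cast
    rw [sqrt_hat2 ht]
    generalize cZ (lam2 / (2 * Real.pi / L) ^ 2) = cz
    generalize Real.sqrt (cz * S1n L lam2 * (4 * Real.pi ^ 2 / (2 * Real.pi / ↑L) ^ 2)) = sq
    field_simp
  · push_cast
    generalize cZ (lam2 / (2 * Real.pi / L) ^ 2) = cz
    field_simp
  · rw [sqrt_hat1]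
    generalize cZ (lam2 / (2 * Real.pi / L) ^ 2) = cz
    generalize Real.sqrt (cz * S2n L lam2 * S1n L lam2) = sq
    field_simp

/-- ★ `bspE ↦ bspAt/(V³t)`. [folklore] -/
theorem eval_bspE (hL : 128 ≤ L) (hΔ0 : 0 ≤ Δ) (hΔ1 : Δ < 1) (hf : IsGroundTwoMagnon L Δ lam2 f) (k k' : Bool) :
    (bspE k k').eval (xTrueD L Δ lam2 f) = bspAt L Δ lam2 f k k' / (((L : ℝ) ^ 2) ^ 3 * (2 * Real.pi / L) ^ 2) := by
  obtain ⟨h0, h1, h3, h4, hcs, hS1, -, -, hK3, hV⟩ := atom_facts L Δ lam2 f hL hΔ0 hΔ1 hf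
  have hLpos : (0 : ℝ) < L := by exact_mod_cast (show 0 < L by omega)
  have ht : 0 < (2 * Real.pi / L : ℝ) ^ 2 := by positivity
  have hπ : Real.pi ≠ 0 := Real.pi_ne_zero
  unfold bspAt bsp
  rw [hV]
  cases k <;> cases k' <;>
    simp only [bspE, RExpr.eval, cst, vA, vS2, vT, vPi2, h0, h1, h3, h4, hcs, hS1, hK3]
  · push_cast
    field_simp
  · field_simp
  · field_simp
  · field_simp

end evals

end RowD

end Summit.HubbardSuperconductivity.HubbardSuperconductivity.Theorems.AnisotropyChord.Transfer.Fibre3
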